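import Mathlib
import HarnessLib
import Literature.MathematicalPhysics.QuantumFieldTheory.Balaban1983to89.B13Contraction113
import Literature.MathematicalPhysics.QuantumFieldTheory.Balaban1983to89.B12Lineariz267
import Literature.MathematicalPhysics.QuantumFieldTheory.Balaban1983to89.B12LinearizAnalytic267
import Literature.MathematicalPhysics.QuantumFieldTheory.Balaban1983to89.MatrixLog
import Literature.MathematicalPhysics.QuantumFieldTheory.Balaban1983to89.B12JacobianTrLog268

/-!
# B12 [Balaban1987RG1] (2.12) p. 268 — the term «Tr log(I − h((δ/δB)D̃)(g_kCB))» at COMPLEX small fields: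
# `Tr log DΦ` is THE continuous logarithm of the Jacobian determinant `det DΦ` on the ball `‖B‖ < ε`
# normalised by `Tr log DΦ(0) = 0`, and it is the principal `log det DΦ(B)` wherever `|Tr log DΦ(B)| < π`

CITATION. T. Bałaban, *Renormalization group approach to lattice gauge field theories. I. Generation of effective
actions in a small field approximation and a coupling constant renormalization in four dimensions*, Commun. Math.
Phys. 109 (1987) 249–301 [Balaban1987RG1] ("B12" of the cell), (2.12) p. 268 (render `…1987-cmp109-rg-I-small-field
-p020`; PDF page = journal page − 248), with p. 267 (`-p019`).  This file sits on top of the tree leaf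
`B12JacobianTrLog268` (the operator `log DΦ(B) := mlog (1 − J(B))`, `J(B) = h∘DD̃(B)`; in finite dimension
`B ↦ Tr log DΦ(B)` analytic on the ball, `Tr log DΦ(0) = 0`, `exp (Tr log DΦ(B)) = det DΦ(B)`, and the size
`|Tr log DΦ(B)| ≤ dim 𝒴 · (−log(1 − 18C₂b‖B‖))`), imported and used BY NAME; the sibling leaf `B12TrLogReal268`
treats REAL fields (there `Tr log DΦ(B₀) = log det DΦ(B₀)` as real numbers); this file is the COMPLEX-field
complement and does not import it.

THE PRINT (verbatim).  B12 p. 267 [PDF 19]: *«We are looking for an analytic, 𝐠-valued function D̃(B′), defined at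
bonds of T⁽ᵏ⁺¹⁾, and such that the transformation B′ = B − hD̃(B) linearizes the function Q̃(B′).»* … *«The above
change of variables yields the integral with the δ-function δ(Q̃B).»*; the substitution is made in (2.10)
*«(2.1) = logN_k′⁻¹ ∫ dB′σ(B′)δ(Q̃(B′)) × χ_k exp[…]»* and its Jacobian is written in the new action (2.12) p. 268
[PDF 20] as the term *«Tr log(I − h((δ/δB)D̃)(g_kCB))»* inside the exponent.  READING: the action of (2.12) is
used as an ANALYTIC function of the (complexified, small) field, and the Jacobian enters it through `Tr log DΦ`
rather than through `log det DΦ`; the two expressions define the same analytic function exactly when `Tr log DΦ`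
is the branch of `log det DΦ` singled out by continuity from `B = 0` (where `DΦ(0) = I`, `Tr log DΦ(0) = 0`).
`B12JacobianTrLog268` proved `exp (Tr log DΦ(B)) = det DΦ(B)` — which determines `Tr log DΦ(B)` only modulo
`2πiℤ` — and listed the identification with (a branch of) `log det` as NOT TYPED; `B12TrLogReal268` settled it at
REAL fields; this file settles it at COMPLEX fields in the form that is true: uniqueness of the normalised
continuous logarithm on the (connected) ball, and agreement with the principal branch where `|Tr log DΦ| < π`.

THE TYPING (schematic, exactly as in `B12JacobianTrLog268` — cell DIVERGENCE row for this file).  `𝒴`, `𝒳`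
complex Banach spaces, `𝒴` finite-dimensional where traces and determinants occur; `hop : 𝒳 →ₗ[ℂ] 𝒴` (print's `h`)
with `‖hop X‖ ≤ b‖X‖`; `Ct : 𝒴 → 𝒳` (print's `C̃`) with `QuadAnalytic Ct C₂ R` and `AnalyticOnNhd ℂ Ct {‖Y‖ < R}`;
smallness `9C₂bε ≤ 1/2`, `3ε ≤ R`; `D̃` HYPOTHESIS-STYLE: any `Dt : 𝒴 → 𝒳` with `Dt B ∈ closedBall 0 (4C₂ε²)` and
`Ct (B − hop (Dt B)) = Dt B` on `‖B‖ < ε`.  `J(B) := hop.mkContinuous b hHop ∘L fderiv ℂ Dt B`,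
`log DΦ(B) := mlog (1 − J(B))`, `Tr` = `LinearMap.trace ℂ 𝒴`, `det DΦ(B)` = `LinearMap.det (fderiv ℂ Φ B)` with
`Φ(B) = B − hop (Dt B)`; the ball is `Metric.ball (0:𝒴) ε`.

CONTENT.  §1 [folklore] GENERIC: two continuous functions into `ℂ` on a preconnected set with equal exponentials
and one common value agree (`eqOn_of_cexp_eq` — Mathlib's covering map `Complex.isCoveringMap_exp` and the
uniqueness of lifts `IsCoveringMap.eqOn_of_comp_eqOn`, used BY NAME), hence a continuous logarithm of a given
function on a preconnected set is unique once normalised at one point (`eqOn_of_cexp_eq_of_cexp_eq`); and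
`exp t = d` with `‖t‖ < π` forces `t = Complex.log d` (`eq_clog_of_cexp_eq_of_norm_lt_pi`, Mathlib `Complex.log_exp`).
§2 [folklore] THE JACOBIAN: `B ↦ Tr log DΦ(B)` is continuous on the ball (`continuousOn_trace_logJacobian`, from
`B12JacobianTrLog268.analyticOnNhd_trace_logJacobian`); UNIQUENESS: every `g` continuous on the ball with
`exp (g B) = det DΦ(B)` there and `g 0 = 0` coincides with `Tr log DΦ` on the ball
(`eqOn_trace_logJacobian_of_continuous_log`), and two such `g` coincide (`continuous_log_det_unique`); PRINCIPAL
BRANCH: `Tr log DΦ(B₀) = Complex.log (det DΦ(B₀))` whenever `‖Tr log DΦ(B₀)‖ < π`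
(`trace_logJacobian_eq_clog_det_of_norm_lt_pi`), in particular whenever
`dim 𝒴 · (−log(1 − 18C₂b‖B₀‖)) < π` (`trace_logJacobian_eq_clog_det_of_finrank_bound`, by
`B12JacobianTrLog268.norm_trace_logJacobian_le_finrank`) or `‖B₀‖ ≤ ε/2 ∧ 36 · dim 𝒴 · C₂b‖B₀‖ < π`
(`trace_logJacobian_eq_clog_det_of_linear_bound`), and EVENTUALLY near `B = 0`
(`eventually_trace_logJacobian_eq_clog_det`, continuity at `0` with value `0`).  §3 a transcription theorem [cite]
and the degenerate model (`𝒳 = 𝒴 = ℂ`, `J = 0`) showing the hypotheses are jointly satisfiable.  NOT TYPED: a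
dimension-UNIFORM region on which `Tr log DΦ = Complex.log det DΦ` (none is claimed: the principal branch may jump
where `|Im Tr log DΦ| ≥ π`, which the schematic bounds allow in large dimension), the concrete lattice objects of
[B12], the measure-theoretic change of variables.  Everything is [folklore] except §3; nothing of [B12] is
asserted; NOT summit progress.
-/

open Metric Set Filter Topology

namespace Literature.MathematicalPhysics.QuantumFieldTheory.Balaban1983to89.B12TrLogBranch268

open Literature.MathematicalPhysics.QuantumFieldTheory.Balaban1983to89.B13Contraction113
open Literature.MathematicalPhysics.QuantumFieldTheory.Balaban1983to89.B12Lineariz267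
open Literature.MathematicalPhysics.QuantumFieldTheory.Balaban1983to89.MatrixLog
open Literature.MathematicalPhysics.QuantumFieldTheory.Balaban1983to89.B12JacobianTrLog268

/-! ## §1  Continuous logarithms on a preconnected set are unique; small logarithms are principal -/
section generic

variable {E : Type*} [TopologicalSpace E] {S : Set E}

/-- **Two continuous logarithms agree.**  If `f`, `g` are continuous on a preconnected `S` with
`exp (f x) = exp (g x)` on `S` and `f x₀ = g x₀` at one point `x₀ ∈ S`, then `f = g` on `S` — uniqueness of lifts
through the covering map `exp : ℂ → ℂ ∖ {0}` (Mathlib `Complex.isCoveringMap_exp`,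
`IsCoveringMap.eqOn_of_comp_eqOn`). [folklore] -/
theorem eqOn_of_cexp_eq (hS : IsPreconnected S) {f g : E → ℂ} (hf : ContinuousOn f S)
    (hg : ContinuousOn g S) (hexp : ∀ x ∈ S, Complex.exp (f x) = Complex.exp (g x)) {x₀ : E}
    (hx₀ : x₀ ∈ S) (h₀ : f x₀ = g x₀) : EqOn f g S :=
  Complex.isCoveringMap_exp.eqOn_of_comp_eqOn hS hf hg (fun x hx => Subtype.ext (hexp x hx)) hx₀ h₀

/-- **A normalised continuous logarithm of a given function is unique**: if `f`, `g` are continuous on a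
preconnected `S`, both satisfy `exp ∘ · = F` on `S`, and agree at one point of `S`, they agree on `S`.
[folklore] -/
theorem eqOn_of_cexp_eq_of_cexp_eq (hS : IsPreconnected S) {f g F : E → ℂ} (hf : ContinuousOn f S)
    (hg : ContinuousOn g S) (hfe : ∀ x ∈ S, Complex.exp (f x) = F x)
    (hge : ∀ x ∈ S, Complex.exp (g x) = F x) {x₀ : E} (hx₀ : x₀ ∈ S) (h₀ : f x₀ = g x₀) : EqOn f g S :=
  eqOn_of_cexp_eq hS hf hg (fun x hx => by rw [hfe x hx, hge x hx]) hx₀ h₀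

/-- **A small logarithm is the principal one**: `exp t = d` and `‖t‖ < π` give `t = Complex.log d`
(`|Im t| ≤ ‖t‖ < π` and Mathlib `Complex.log_exp`). [folklore] -/
theorem eq_clog_of_cexp_eq_of_norm_lt_pi {t d : ℂ} (hexp : Complex.exp t = d) (ht : ‖t‖ < Real.pi) :
    t = Complex.log d := by
  have him : |t.im| < Real.pi := lt_of_le_of_lt (Complex.abs_im_le_norm t) ht
  rw [← hexp, Complex.log_exp (by linarith [neg_abs_le t.im])
    (le_of_lt (lt_of_le_of_lt (le_abs_self _) him))]

end generic

/-! ## §2  `Tr log DΦ` is the normalised continuous branch of `log det DΦ` on the ball -/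
section jacobian

variable {𝒳 𝒴 : Type*} [NormedAddCommGroup 𝒳] [NormedSpace ℂ 𝒳] [CompleteSpace 𝒳]
  [NormedAddCommGroup 𝒴] [NormedSpace ℂ 𝒴] [CompleteSpace 𝒴] [FiniteDimensional ℂ 𝒴]
  {hop : 𝒳 →ₗ[ℂ] 𝒴} {Ct : 𝒴 → 𝒳} {C₂ R b ε : ℝ} {Dt : 𝒴 → 𝒳}

/-- **`B ↦ Tr log DΦ(B)` is continuous on the ball `‖B‖ < ε`** (it is analytic there,
`B12JacobianTrLog268.analyticOnNhd_trace_logJacobian`). [folklore] -/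
theorem continuousOn_trace_logJacobian (hC : QuadAnalytic Ct C₂ R)
    (hCa : AnalyticOnNhd ℂ Ct {Y : 𝒴 | ‖Y‖ < R})
    (hC₂ : 0 ≤ C₂) (hb : 0 ≤ b) (hHop : ∀ X, ‖hop X‖ ≤ b * ‖X‖) (hq2 : 9 * C₂ * b * ε ≤ 1 / 2)
    (hRC : 3 * ε ≤ R) (hDball : ∀ B : 𝒴, ‖B‖ < ε → Dt B ∈ closedBall (0:𝒳) (4 * C₂ * ε ^ 2))
    (hDfix : ∀ B : 𝒴, ‖B‖ < ε → Ct (B - hop (Dt B)) = Dt B) :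
    ContinuousOn (fun B : 𝒴 => LinearMap.trace ℂ 𝒴
      ((mlog (1 - hop.mkContinuous b hHop ∘L fderiv ℂ Dt B) : 𝒴 →L[ℂ] 𝒴) : 𝒴 →ₗ[ℂ] 𝒴)) (ball (0:𝒴) ε) :=
  (analyticOnNhd_trace_logJacobian hC hCa hC₂ hb hHop hq2 hRC hDball hDfix).continuousOn

/-- **UNIQUENESS OF THE NORMALISED CONTINUOUS LOGARITHM OF THE JACOBIAN: it is `Tr log DΦ`.**  If `g` is continuous
on the ball `‖B‖ < ε` (`ε > 0`), `exp (g B) = det DΦ(B)` there, and `g 0 = 0`, then `g B = Tr log DΦ(B)` on the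
ball.  Ingredients: the ball is convex hence preconnected; `Tr log DΦ` is continuous there with
`exp (Tr log DΦ(B)) = det DΦ(B)` (`B12JacobianTrLog268.cexp_trace_logJacobian_eq_det_fderiv_phi`) and
`Tr log DΦ(0) = 0` (`B12JacobianTrLog268.trace_logJacobian_zero`); §1. [folklore] -/
theorem eqOn_trace_logJacobian_of_continuous_log (hC : QuadAnalytic Ct C₂ R)
    (hCa : AnalyticOnNhd ℂ Ct {Y : 𝒴 | ‖Y‖ < R})
    (hC₂ : 0 ≤ C₂) (hb : 0 ≤ b) (hHop : ∀ X, ‖hop X‖ ≤ b * ‖X‖) (hq2 : 9 * C₂ * b * ε ≤ 1 / 2)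
    (hRC : 3 * ε ≤ R) (hDball : ∀ B : 𝒴, ‖B‖ < ε → Dt B ∈ closedBall (0:𝒳) (4 * C₂ * ε ^ 2))
    (hDfix : ∀ B : 𝒴, ‖B‖ < ε → Ct (B - hop (Dt B)) = Dt B) (hε : 0 < ε)
    {g : 𝒴 → ℂ} (hg : ContinuousOn g (ball (0:𝒴) ε))
    (hge : ∀ B ∈ ball (0:𝒴) ε, Complex.exp (g B) =
      LinearMap.det ((fderiv ℂ (fun B => B - hop (Dt B)) B : 𝒴 →L[ℂ] 𝒴) : 𝒴 →ₗ[ℂ] 𝒴))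
    (hg0 : g 0 = 0) :
    EqOn g (fun B : 𝒴 => LinearMap.trace ℂ 𝒴
      ((mlog (1 - hop.mkContinuous b hHop ∘L fderiv ℂ Dt B) : 𝒴 →L[ℂ] 𝒴) : 𝒴 →ₗ[ℂ] 𝒴)) (ball (0:𝒴) ε) :=
  eqOn_of_cexp_eq_of_cexp_eq (convex_ball (0:𝒴) ε).isPreconnected hg
    (continuousOn_trace_logJacobian hC hCa hC₂ hb hHop hq2 hRC hDball hDfix) hge
    (fun B hB => cexp_trace_logJacobian_eq_det_fderiv_phi hC hCa hC₂ hb hHop hq2 hRC hDball hDfix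
      (mem_ball_zero_iff.mp hB))
    (mem_ball_self hε)
    (by rw [hg0, trace_logJacobian_zero hC hCa hC₂ hb hHop (lt_one_of_le_half hq2) hRC hDball hDfix hε])

/-- **Two normalised continuous logarithms of the Jacobian determinant on the ball coincide** (both are
`Tr log DΦ`). [folklore] -/
theorem continuous_log_det_unique (hC : QuadAnalytic Ct C₂ R)
    (hCa : AnalyticOnNhd ℂ Ct {Y : 𝒴 | ‖Y‖ < R})
    (hC₂ : 0 ≤ C₂) (hb : 0 ≤ b) (hHop : ∀ X, ‖hop X‖ ≤ b * ‖X‖) (hq2 : 9 * C₂ * b * ε ≤ 1 / 2)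
    (hRC : 3 * ε ≤ R) (hDball : ∀ B : 𝒴, ‖B‖ < ε → Dt B ∈ closedBall (0:𝒳) (4 * C₂ * ε ^ 2))
    (hDfix : ∀ B : 𝒴, ‖B‖ < ε → Ct (B - hop (Dt B)) = Dt B) (hε : 0 < ε)
    {g₁ g₂ : 𝒴 → ℂ} (hg₁ : ContinuousOn g₁ (ball (0:𝒴) ε)) (hg₂ : ContinuousOn g₂ (ball (0:𝒴) ε))
    (hg₁e : ∀ B ∈ ball (0:𝒴) ε, Complex.exp (g₁ B) =
      LinearMap.det ((fderiv ℂ (fun B => B - hop (Dt B)) B : 𝒴 →L[ℂ] 𝒴) : 𝒴 →ₗ[ℂ] 𝒴))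
    (hg₂e : ∀ B ∈ ball (0:𝒴) ε, Complex.exp (g₂ B) =
      LinearMap.det ((fderiv ℂ (fun B => B - hop (Dt B)) B : 𝒴 →L[ℂ] 𝒴) : 𝒴 →ₗ[ℂ] 𝒴))
    (hg₁0 : g₁ 0 = 0) (hg₂0 : g₂ 0 = 0) : EqOn g₁ g₂ (ball (0:𝒴) ε) :=
  fun _ hB =>
    (eqOn_trace_logJacobian_of_continuous_log hC hCa hC₂ hb hHop hq2 hRC hDball hDfix hε hg₁ hg₁e hg₁0
        hB).trans
      (eqOn_trace_logJacobian_of_continuous_log hC hCa hC₂ hb hHop hq2 hRC hDball hDfix hε hg₂ hg₂e hg₂0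
        hB).symm

/-- **PRINCIPAL BRANCH where the term is small: `‖Tr log DΦ(B₀)‖ < π ⇒ Tr log DΦ(B₀) = Complex.log (det DΦ(B₀))`.**
[folklore] -/
theorem trace_logJacobian_eq_clog_det_of_norm_lt_pi (hC : QuadAnalytic Ct C₂ R)
    (hCa : AnalyticOnNhd ℂ Ct {Y : 𝒴 | ‖Y‖ < R})
    (hC₂ : 0 ≤ C₂) (hb : 0 ≤ b) (hHop : ∀ X, ‖hop X‖ ≤ b * ‖X‖) (hq2 : 9 * C₂ * b * ε ≤ 1 / 2)
    (hRC : 3 * ε ≤ R) (hDball : ∀ B : 𝒴, ‖B‖ < ε → Dt B ∈ closedBall (0:𝒳) (4 * C₂ * ε ^ 2))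
    (hDfix : ∀ B : 𝒴, ‖B‖ < ε → Ct (B - hop (Dt B)) = Dt B) {B₀ : 𝒴} (hB₀ : ‖B₀‖ < ε)
    (hπ : ‖LinearMap.trace ℂ 𝒴
        ((mlog (1 - hop.mkContinuous b hHop ∘L fderiv ℂ Dt B₀) : 𝒴 →L[ℂ] 𝒴) : 𝒴 →ₗ[ℂ] 𝒴)‖ < Real.pi) :
    LinearMap.trace ℂ 𝒴 ((mlog (1 - hop.mkContinuous b hHop ∘L fderiv ℂ Dt B₀) : 𝒴 →L[ℂ] 𝒴) : 𝒴 →ₗ[ℂ] 𝒴) =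
      Complex.log (LinearMap.det ((fderiv ℂ (fun B => B - hop (Dt B)) B₀ : 𝒴 →L[ℂ] 𝒴) : 𝒴 →ₗ[ℂ] 𝒴)) :=
  eq_clog_of_cexp_eq_of_norm_lt_pi
    (cexp_trace_logJacobian_eq_det_fderiv_phi hC hCa hC₂ hb hHop hq2 hRC hDball hDfix hB₀) hπ

/-- **Principal branch on an explicit (dimension-dependent) region**: if
`dim 𝒴 · (−log(1 − 18C₂b‖B₀‖)) < π` then `Tr log DΦ(B₀) = Complex.log (det DΦ(B₀))`
(`B12JacobianTrLog268.norm_trace_logJacobian_le_finrank`). [folklore] -/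
theorem trace_logJacobian_eq_clog_det_of_finrank_bound (hC : QuadAnalytic Ct C₂ R)
    (hCa : AnalyticOnNhd ℂ Ct {Y : 𝒴 | ‖Y‖ < R})
    (hC₂ : 0 ≤ C₂) (hb : 0 ≤ b) (hHop : ∀ X, ‖hop X‖ ≤ b * ‖X‖) (hq2 : 9 * C₂ * b * ε ≤ 1 / 2)
    (hRC : 3 * ε ≤ R) (hDball : ∀ B : 𝒴, ‖B‖ < ε → Dt B ∈ closedBall (0:𝒳) (4 * C₂ * ε ^ 2))
    (hDfix : ∀ B : 𝒴, ‖B‖ < ε → Ct (B - hop (Dt B)) = Dt B) {B₀ : 𝒴} (hB₀ : ‖B₀‖ < ε)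
    (hdim : Module.finrank ℂ 𝒴 * (-Real.log (1 - 18 * C₂ * b * ‖B₀‖)) < Real.pi) :
    LinearMap.trace ℂ 𝒴 ((mlog (1 - hop.mkContinuous b hHop ∘L fderiv ℂ Dt B₀) : 𝒴 →L[ℂ] 𝒴) : 𝒴 →ₗ[ℂ] 𝒴) =
      Complex.log (LinearMap.det ((fderiv ℂ (fun B => B - hop (Dt B)) B₀ : 𝒴 →L[ℂ] 𝒴) : 𝒴 →ₗ[ℂ] 𝒴)) :=
  trace_logJacobian_eq_clog_det_of_norm_lt_pi hC hCa hC₂ hb hHop hq2 hRC hDball hDfix hB₀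
    ((norm_trace_logJacobian_le_finrank hC hCa hC₂ hb hHop hq2 hRC hDball hDfix hB₀).trans_lt hdim)

/-- … and with the LINEAR size on the half ball: `‖B₀‖ ≤ ε/2` and `dim 𝒴 · 36C₂b‖B₀‖ < π` give
`Tr log DΦ(B₀) = Complex.log (det DΦ(B₀))` (`B12JacobianTrLog268.norm_trace_logJacobian_le_linear`). [folklore] -/
theorem trace_logJacobian_eq_clog_det_of_linear_bound (hC : QuadAnalytic Ct C₂ R)
    (hCa : AnalyticOnNhd ℂ Ct {Y : 𝒴 | ‖Y‖ < R})
    (hC₂ : 0 ≤ C₂) (hb : 0 ≤ b) (hHop : ∀ X, ‖hop X‖ ≤ b * ‖X‖) (hq2 : 9 * C₂ * b * ε ≤ 1 / 2)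
    (hRC : 3 * ε ≤ R) (hDball : ∀ B : 𝒴, ‖B‖ < ε → Dt B ∈ closedBall (0:𝒳) (4 * C₂ * ε ^ 2))
    (hDfix : ∀ B : 𝒴, ‖B‖ < ε → Ct (B - hop (Dt B)) = Dt B) {B₀ : 𝒴} (hB₀ : ‖B₀‖ < ε)
    (hhalf : ‖B₀‖ ≤ ε / 2) (hdim : Module.finrank ℂ 𝒴 * (36 * C₂ * b * ‖B₀‖) < Real.pi) :
    LinearMap.trace ℂ 𝒴 ((mlog (1 - hop.mkContinuous b hHop ∘L fderiv ℂ Dt B₀) : 𝒴 →L[ℂ] 𝒴) : 𝒴 →ₗ[ℂ] 𝒴) =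
      Complex.log (LinearMap.det ((fderiv ℂ (fun B => B - hop (Dt B)) B₀ : 𝒴 →L[ℂ] 𝒴) : 𝒴 →ₗ[ℂ] 𝒴)) :=
  trace_logJacobian_eq_clog_det_of_norm_lt_pi hC hCa hC₂ hb hHop hq2 hRC hDball hDfix hB₀
    ((norm_trace_logJacobian_le_linear hC hCa hC₂ hb hHop hq2 hRC hDball hDfix hB₀ hhalf).trans_lt hdim)

/-- **Near `B = 0` the term IS the principal `log det`**: for all `B₀` in a neighbourhood of `0`,
`Tr log DΦ(B₀) = Complex.log (det DΦ(B₀))` (`Tr log DΦ` is continuous at `0` with value `0`, so eventually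
`‖Tr log DΦ(B₀)‖ < π`). [folklore] -/
theorem eventually_trace_logJacobian_eq_clog_det (hC : QuadAnalytic Ct C₂ R)
    (hCa : AnalyticOnNhd ℂ Ct {Y : 𝒴 | ‖Y‖ < R})
    (hC₂ : 0 ≤ C₂) (hb : 0 ≤ b) (hHop : ∀ X, ‖hop X‖ ≤ b * ‖X‖) (hq2 : 9 * C₂ * b * ε ≤ 1 / 2)
    (hRC : 3 * ε ≤ R) (hDball : ∀ B : 𝒴, ‖B‖ < ε → Dt B ∈ closedBall (0:𝒳) (4 * C₂ * ε ^ 2))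
    (hDfix : ∀ B : 𝒴, ‖B‖ < ε → Ct (B - hop (Dt B)) = Dt B) (hε : 0 < ε) :
    ∀ᶠ B₀ in 𝓝 (0:𝒴),
      LinearMap.trace ℂ 𝒴 ((mlog (1 - hop.mkContinuous b hHop ∘L fderiv ℂ Dt B₀) : 𝒴 →L[ℂ] 𝒴) : 𝒴 →ₗ[ℂ] 𝒴) =
        Complex.log (LinearMap.det ((fderiv ℂ (fun B => B - hop (Dt B)) B₀ : 𝒴 →L[ℂ] 𝒴) : 𝒴 →ₗ[ℂ] 𝒴)) := by
  have hcont : ContinuousAt (fun B : 𝒴 => LinearMap.trace ℂ 𝒴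
      ((mlog (1 - hop.mkContinuous b hHop ∘L fderiv ℂ Dt B) : 𝒴 →L[ℂ] 𝒴) : 𝒴 →ₗ[ℂ] 𝒴)) 0 :=
    (continuousOn_trace_logJacobian hC hCa hC₂ hb hHop hq2 hRC hDball hDfix).continuousAt
      (isOpen_ball.mem_nhds (mem_ball_self hε))
  have h0 := trace_logJacobian_zero hC hCa hC₂ hb hHop (lt_one_of_le_half hq2) hRC hDball hDfix hε
  have hnorm : Tendsto (fun B : 𝒴 => ‖LinearMap.trace ℂ 𝒴
      ((mlog (1 - hop.mkContinuous b hHop ∘L fderiv ℂ Dt B) : 𝒴 →L[ℂ] 𝒴) : 𝒴 →ₗ[ℂ] 𝒴)‖) (𝓝 0) (𝓝 0) := by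
    have h := hcont.tendsto.norm
    rwa [h0, norm_zero] at h
  have hsmall : ∀ᶠ B₀ in 𝓝 (0:𝒴), ‖LinearMap.trace ℂ 𝒴
      ((mlog (1 - hop.mkContinuous b hHop ∘L fderiv ℂ Dt B₀) : 𝒴 →L[ℂ] 𝒴) : 𝒴 →ₗ[ℂ] 𝒴)‖ < Real.pi :=
    hnorm.eventually_lt_const Real.pi_pos
  have hball : ∀ᶠ B₀ in 𝓝 (0:𝒴), ‖B₀‖ < ε := by
    filter_upwards [isOpen_ball.mem_nhds (mem_ball_self (x := (0:𝒴)) hε)] with B hB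
    exact mem_ball_zero_iff.mp hB
  filter_upwards [hsmall, hball] with B₀ h₁ h₂
  exact trace_logJacobian_eq_clog_det_of_norm_lt_pi hC hCa hC₂ hb hHop hq2 hRC hDball hDfix h₂ h₁

end jacobian

/-! ## §3  Transcription of the (2.12) term at complex small fields -/
section transcription

variable {𝒳 𝒴 : Type*} [NormedAddCommGroup 𝒳] [NormedSpace ℂ 𝒳] [CompleteSpace 𝒳]
  [NormedAddCommGroup 𝒴] [NormedSpace ℂ 𝒴] [CompleteSpace 𝒴] [FiniteDimensional ℂ 𝒴]

/-- **B12 (2.12) p. 268 — the term «Tr log(I − h((δ/δB)D̃)(g_kCB))» as an analytic function of the COMPLEX small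
field.**  For the hypothesis-style `D̃` of `B12Lineariz267`, under the hypotheses of
`B12JacobianTrLog268.p268_TrLog_jacobian_term_findim` (`𝒴` finite-dimensional, `9C₂bε ≤ 1/2`, `ε > 0`), with
`Tr log DΦ(B) = Tr mlog (1 − h∘DD̃(B))` and `det DΦ(B) = det (fderiv ℂ Φ B)`, `Φ(B) = B − hD̃(B)`:
(i) `Tr log DΦ` is continuous on the ball `‖B‖ < ε`, vanishes at `B = 0`, and `exp (Tr log DΦ(B)) = det DΦ(B)`
there; (ii) UNIQUENESS — every function continuous on the ball with `exp ∘ g = det DΦ` and `g(0) = 0` IS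
`Tr log DΦ` on the ball: the (2.12) term is THE branch of `log det DΦ` obtained by continuity from `B = 0`;
(iii) it is the PRINCIPAL `Complex.log (det DΦ(B₀))` wherever `‖Tr log DΦ(B₀)‖ < π`, in particular wherever
`dim 𝒴 · (−log(1 − 18C₂b‖B₀‖)) < π`, and for all `B₀` near `0`.  Everything about `D̃`, `C̃`, `h` is a HYPOTHESIS;
nothing printed is asserted. [cite: Balaban1987RG1, (2.12) p.268] -/
theorem p268_TrLog_branch {hop : 𝒳 →ₗ[ℂ] 𝒴} {Ct : 𝒴 → 𝒳} {C₂ R b ε : ℝ} {Dt : 𝒴 → 𝒳}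
    (hC : QuadAnalytic Ct C₂ R) (hCa : AnalyticOnNhd ℂ Ct {Y : 𝒴 | ‖Y‖ < R})
    (hC₂ : 0 ≤ C₂) (hb : 0 ≤ b) (hHop : ∀ X, ‖hop X‖ ≤ b * ‖X‖) (hq2 : 9 * C₂ * b * ε ≤ 1 / 2)
    (hRC : 3 * ε ≤ R) (hDball : ∀ B : 𝒴, ‖B‖ < ε → Dt B ∈ closedBall (0:𝒳) (4 * C₂ * ε ^ 2))
    (hDfix : ∀ B : 𝒴, ‖B‖ < ε → Ct (B - hop (Dt B)) = Dt B) (hε : 0 < ε) :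
    (ContinuousOn (fun B : 𝒴 => LinearMap.trace ℂ 𝒴
        ((mlog (1 - hop.mkContinuous b hHop ∘L fderiv ℂ Dt B) : 𝒴 →L[ℂ] 𝒴) : 𝒴 →ₗ[ℂ] 𝒴)) (ball (0:𝒴) ε) ∧
      LinearMap.trace ℂ 𝒴
          ((mlog (1 - hop.mkContinuous b hHop ∘L fderiv ℂ Dt (0 : 𝒴)) : 𝒴 →L[ℂ] 𝒴) : 𝒴 →ₗ[ℂ] 𝒴) = 0 ∧
      ∀ B₀ ∈ ball (0:𝒴) ε, Complex.exp (LinearMap.trace ℂ 𝒴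
          ((mlog (1 - hop.mkContinuous b hHop ∘L fderiv ℂ Dt B₀) : 𝒴 →L[ℂ] 𝒴) : 𝒴 →ₗ[ℂ] 𝒴)) =
        LinearMap.det ((fderiv ℂ (fun B => B - hop (Dt B)) B₀ : 𝒴 →L[ℂ] 𝒴) : 𝒴 →ₗ[ℂ] 𝒴)) ∧
    (∀ g : 𝒴 → ℂ, ContinuousOn g (ball (0:𝒴) ε) →
      (∀ B ∈ ball (0:𝒴) ε, Complex.exp (g B) =
        LinearMap.det ((fderiv ℂ (fun B => B - hop (Dt B)) B : 𝒴 →L[ℂ] 𝒴) : 𝒴 →ₗ[ℂ] 𝒴)) →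
      g 0 = 0 →
      EqOn g (fun B : 𝒴 => LinearMap.trace ℂ 𝒴
        ((mlog (1 - hop.mkContinuous b hHop ∘L fderiv ℂ Dt B) : 𝒴 →L[ℂ] 𝒴) : 𝒴 →ₗ[ℂ] 𝒴)) (ball (0:𝒴) ε)) ∧
    (∀ B₀ : 𝒴, ‖B₀‖ < ε →
      ‖LinearMap.trace ℂ 𝒴
          ((mlog (1 - hop.mkContinuous b hHop ∘L fderiv ℂ Dt B₀) : 𝒴 →L[ℂ] 𝒴) : 𝒴 →ₗ[ℂ] 𝒴)‖ < Real.pi →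
      LinearMap.trace ℂ 𝒴 ((mlog (1 - hop.mkContinuous b hHop ∘L fderiv ℂ Dt B₀) : 𝒴 →L[ℂ] 𝒴) : 𝒴 →ₗ[ℂ] 𝒴) =
        Complex.log (LinearMap.det ((fderiv ℂ (fun B => B - hop (Dt B)) B₀ : 𝒴 →L[ℂ] 𝒴) : 𝒴 →ₗ[ℂ] 𝒴))) ∧
    (∀ B₀ : 𝒴, ‖B₀‖ < ε → Module.finrank ℂ 𝒴 * (-Real.log (1 - 18 * C₂ * b * ‖B₀‖)) < Real.pi →
      LinearMap.trace ℂ 𝒴 ((mlog (1 - hop.mkContinuous b hHop ∘L fderiv ℂ Dt B₀) : 𝒴 →L[ℂ] 𝒴) : 𝒴 →ₗ[ℂ] 𝒴) =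
        Complex.log (LinearMap.det ((fderiv ℂ (fun B => B - hop (Dt B)) B₀ : 𝒴 →L[ℂ] 𝒴) : 𝒴 →ₗ[ℂ] 𝒴))) ∧
    (∀ᶠ B₀ in 𝓝 (0:𝒴),
      LinearMap.trace ℂ 𝒴 ((mlog (1 - hop.mkContinuous b hHop ∘L fderiv ℂ Dt B₀) : 𝒴 →L[ℂ] 𝒴) : 𝒴 →ₗ[ℂ] 𝒴) =
        Complex.log (LinearMap.det ((fderiv ℂ (fun B => B - hop (Dt B)) B₀ : 𝒴 →L[ℂ] 𝒴) : 𝒴 →ₗ[ℂ] 𝒴))) :=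
  ⟨⟨continuousOn_trace_logJacobian hC hCa hC₂ hb hHop hq2 hRC hDball hDfix,
      trace_logJacobian_zero hC hCa hC₂ hb hHop (lt_one_of_le_half hq2) hRC hDball hDfix hε,
      fun _ hB₀ => cexp_trace_logJacobian_eq_det_fderiv_phi hC hCa hC₂ hb hHop hq2 hRC hDball hDfix
        (mem_ball_zero_iff.mp hB₀)⟩,
    fun _ hg hge hg0 =>
      eqOn_trace_logJacobian_of_continuous_log hC hCa hC₂ hb hHop hq2 hRC hDball hDfix hε hg hge hg0,
    fun _ hB₀ hπ =>
      trace_logJacobian_eq_clog_det_of_norm_lt_pi hC hCa hC₂ hb hHop hq2 hRC hDball hDfix hB₀ hπ,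
    fun _ hB₀ hdim =>
      trace_logJacobian_eq_clog_det_of_finrank_bound hC hCa hC₂ hb hHop hq2 hRC hDball hDfix hB₀ hdim,
    eventually_trace_logJacobian_eq_clog_det hC hCa hC₂ hb hHop hq2 hRC hDball hDfix hε⟩

/-- Non-vacuity of the hypothesis set: the degenerate model `𝒳 = 𝒴 = ℂ`, `h = id`, `C̃ = 0`, `D̃ = 0`, `C₂ = 0`,
`R = 3`, `b = 1`, `ε = 1` (there `J = 0`, `Tr log DΦ = 0 = log 1 = log det DΦ`) satisfies every hypothesis of
`p268_TrLog_branch`. -/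
example := p268_TrLog_branch (𝒳 := ℂ) (𝒴 := ℂ) (hop := LinearMap.id) (Ct := fun _ => 0)
  (C₂ := 0) (R := 3) (b := 1) (ε := 1) (Dt := fun _ => 0)
  ⟨fun Y _ => by simp, fun P Q => differentiableOn_const (0:ℂ)⟩ (fun Y _ => analyticAt_const) le_rfl
  zero_le_one (fun X => by simp) (by norm_num) (by norm_num) (fun B _ => by simp) (fun B _ => by simp) one_pos

end transcription

end Literature.MathematicalPhysics.QuantumFieldTheory.Balaban1983to89.B12TrLogBranch268
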